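import Summits.QuantumFields.BalabanUV.Beta.GAN24.Lin4Additive
import Summits.QuantumFields.BalabanUV.Beta.GAN24.WSlotT2OfPieces
import Summits.QuantumFields.BalabanUV.Beta.SecondOrderRemainderTables
import Summits.QuantumFields.BalabanUV.Beta.TameKernelCalculus
import Summits.QuantumFields.BalabanUV.Gaps.CapTailPinnedLimitSign
import Literature.MathematicalPhysics.QuantumFieldTheory.Balaban1983to89.Beta.ScalewiseWitness

/-!
# `BalabanUV.Gaps.D1PinnedSecondOrderUniversal` — cell pub-balaban-gaps, row (D1), seat g1-p1: THE PINNED LITERAL's SECOND-ORDER RESPONSE IS UNIVERSAL —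
# the response of the one-loop coefficients to the two free second-order data (border weight `cB`, an3's position table `Tc`) DOES NOT SEE THE FIRST-ORDER
# COLOUR CONSTANTS `(cE, cVH, cΛ)`: `β⁰_j(c⃗; cB, Tc) − β⁰_j(c⃗; 0, 0) = β⁰_j(c⃗′; cB, Tc) − β⁰_j(c⃗′; 0, 0)` at every level, hence for the limit, hypothesis-free

HONEST FRAMING (cell rule, page 1 of everything): [folklore] kernel algebra and real-sequence bookkeeping BY NAME over tree theorems — an2's recursion `BalabanStepW2.T2Of`
∕ `WbalOf` ∕ `e4OfW` ∕ `T2Of_loc` ∕ `vertexFamily₂_WbalOf'`, an4's `OneStepKernelFamily.decays_KInvStep` ∕ `hTA_TbalOf`, gan24's affinity letters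
`GAN24.T2RecursionAffine.W2SymOfK_eq_add_vsym` ∕ `K3OfK_eq_sub_of_W` ∕ `lin4` and `GAN24.Lin4Additive.lin4_add` ∕ `vsym_add`, the β sub-cell's
`TameKernelCalculus.tadpole_add`, `ScalewiseWitness.secondMoment_add`, an1's closed form `MixedJetTablesPlug.TbalOf_JsBalAn1`, and g1-p3's hypothesis-free
`CapTailPinnedLimitSign.tendsto_pinned` ∕ `d1Drift_pinned_iff_lim_eq` (gan24-p1's rate).  NOTHING of Bałaban's is asserted beyond print; [Balaban1987RG1] Thm 2 is
UNPROVED IN PRINT; NOTHING here says which colour data are print's ((P6) is the β-lead's ∕ an2's ∕ an3's decision), nor whether the literal's limit actually depends on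
`cB` or `Tc` (the BLIND ∕ GENERIC alternative is NOT decided); 0 coefficients certified; (D1) NOT discharged at any literal; 0∕4 row-D1 binders; NOT `BetaPertH`, NOT
the continuum limit, NOT Clay.  HONEST DEPENDENCY (b2b cell, verbatim): «continuum YM on T⁴ ⇐ BetaPertH ∧ nine spine estimates (0/9 proved); BetaPertH ⇐ (D1) ∧ (D4) ∧
CAP+tail; G-an2-4 gates asym, D1 and NE2/3/4.»

WHY (row (D1); census row 64 of `HOME/g1/RESIDUE.md`; the third of this seat's GEN 10 files on the free second-order data, after `Gaps/D1PinnedSecondOrderModular` (no cross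
term between `cB` and `Tc`) and `Gaps/D1PinnedPositionTableAffine` v2 (affine ∕ linear in `Tc`)).  In an2's recursion the first-order colour constants `c⃗ = (cE, cVH, cΛ)`
enter member `j+1` of `T2Of` ONLY through the `T₂`-FREE part of the value-4-jet read-out (the first tables `Spure c⃗ j`, `M1 cΛ j` inside `e4OfW j … (WbalOf c⃗ … 0 … j)`),
while the part LINEAR in the previous member is gan24's `lin4 1 (KInvStep Lc j) Lc` — an4's step kernel, which carries NO colour constant (§1); member `0` carries none
either.  Hence the RESPONSE of the family to its second-order data, `T2Of(c⃗; cB, T) j − T2Of(c⃗; 0, 0) j`, is the SAME table for every `c⃗` (§2, as the four-member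
identity `T2Of(c⃗;cB,T) j + T2Of(c⃗′;0,0) j = T2Of(c⃗;0,0) j + T2Of(c⃗′;cB,T) j`, induction via `lin4_add`); so is the response of the assembled family (§3, `vsym_add`;
the `T₂`-free carrier depends on `c⃗` but cancels), of the step kernels (§4: the axial dressing `axDressK Lc (KInvStep Lc j)` is colour-free, the bubble halves — which DO
depend on `c⃗` — cancel pairwise, `tadpole_add`), of the (1.22) coefficients (`secondMoment_add`) and of the limit (§5, `tendsto_pinned` ×4).  READINGS (§6, hypothesis-free
at the pin, `2 ≤ Lc`, any box root, any channel): **`secondOrderResponse_indep_firstOrder`** `lim β⁰(c⃗;cB,Tc) − lim β⁰(c⃗;0,0) = lim β⁰(c⃗′;cB,Tc) − lim β⁰(c⃗′;0,0)`;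
**`d1Drift_JsBalAn1_iff_universal`** — (D1) at `(c⃗; cB, Tc)` reads `lim β⁰(c⃗;0,0) + [lim β⁰(0⃗;cB,Tc) − lim β⁰(0⃗;0,0)] = stepBal N Lc` with `0⃗ = (0,0,0)`: ALL the
dependence on the first-order colour constants sits in the base value `lim β⁰(c⃗;0,0)`, and the second-order correction is ONE UNIVERSAL function of `(cB, Tc)` — by
the two sibling files and GEN 9's p370181 an AFFINE one, `cB·σ + λ(Tc)` with `σ ∈ ℝ`, `λ` linear, NOW KNOWN TO BE FREE OF EVERY COLOUR CONSTANT (functions of `Lc`,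
the root and the channel alone); **`blind_everywhere_of_blind_somewhere`** ∕ **`d1Drift_blind_everywhere_of_blind_somewhere`** — if the limit ignores `(cB, Tc)` at ONE
value of the first-order constants (e.g. at `c⃗ = 0⃗`, where an2's first-order tables carry the factor `0`) then it ignores them at EVERY value.  So the open alternative
«is (D1) at the pinned literal blind to its free second-order data?» is ONE question about an4's kernel tower `KInvStep`, an1's border ∕ mixed tables and an3's
`wilsonW₂` ALONE (no colour constant involved) — recorded in the census as the row's sharpest compute target; NOT decided here.
CONTENT (all [folklore]; no `def`, no `def … : Prop`, nothing cited as a hypothesis, 0 sorry): §1 two PRIVATE re-derivations (statements and proofs verbatim) of GEN 9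
letters of `Gaps/D1PinnedBorderWeightAffine` (its §1 read-out lemma and `JsBal0Of_S_indep`; that module has no farm olean at the time of writing); §2
**`T2Of_response_universal`** (generic `d`, `1 ≤ Lc`, any `cE₂`, any two triples of first-order constants, certified border ∕ mixed tables); §3
**`WbalOf_T2Of_response_universal`**; §4 `hessKer_modular_W₂` (two bubble families), **`TbalOf_JsBalAn1_response_universal`**, **`secondMoment_JsBalAn1_response_universal`**
(`d = 3`, any box root, any `cE₂`); §5 **`lim_JsBalAn1_response_universal`** (the pin); §6 as above.

ABSOLUTE RULE (cell charter, verbatim): «No internally-minted statement may enter as a cited fact. Every hypothesis is either kernel-proved in this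
package or a verbatim quotation of a PUBLISHED theorem with page reference. The manuscript(s) under audit are NOT citable for their own disputed
steps — they are the thing under adjudication; programme-internal (2001/route/tribunal) claims are never citable.»

Provenance: cell pub-balaban-gaps, seat g1-p1 GEN 10 (prover-pub-balaban-gaps-g1-p1-g10-0), 2026-08-23; imports gan24's `GAN24.Lin4Additive` ∕ `GAN24.WSlotT2OfPieces`, the β
sub-cell's `SecondOrderRemainderTables` ∕ `TameKernelCalculus`, g1-p3's `Gaps/CapTailPinnedLimitSign`, and the Literature `Beta.ScalewiseWitness` ONLY (all with farm
oleans); independent of the sibling files; every tree theorem used BY NAME; no existing file touched.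
-/

noncomputable section
open Literature.MathematicalPhysics.QuantumFieldTheory Balaban1983to89 Balaban1983to89.Beta Filter Topology
open ExpKernelCalculus (MKer Decays BiLoc VertexFamily₂ comp hessKer tadpole)
open OneStepResolventKernel (Fib decays_mono biLoc_mono)
open OneStepKernelFamily (KInvStep decays_KInvStep TbalOf D1Drift hTA_TbalOf)
open SecondOrderResponse (W2SymOfK LocStencilFM)
open BalabanCompositeJets (LocStencil₂)
open BalabanStepJetsSucc (mmRead JsBal0Of)
open BalabanStepW2 (Spure M1 M2Of WbalOf T2Of T2Of_zero T2Of_succ T2Of_loc e4OfW K3OfK wV4 wB2 vertexFamily₂_WbalOf' WbalT2Of CwOf δwOf δwOf_pos WbalOf_loc₂)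
open Summit.QuantumFields.BalabanUV.Beta.GAN24.ThirdJetKernel (mmRead_sub)
open Summit.QuantumFields.BalabanUV.Beta.GAN24.T2RecursionAffine (vsym lin4 lin4_apply W2SymOfK_eq_add_vsym K3OfK_eq_sub_of_W)
open Summit.QuantumFields.BalabanUV.Beta.GAN24.Lin4Additive (lin4_add vsym_add)
open Summit.QuantumFields.BalabanUV.Beta.GAN24.WSlotT2OfPieces (locStencil₂_zero)
open Summit.QuantumFields.BalabanUV.Beta.SecondOrderRemainderTables (abs_le_of_locStencil₂)
open AffineAveraging (box toSite)
open AveragingMixedJetTables (vh₂SAt mixFFAt)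
open RateCertificate (CauchyRate)
open AxialDressing (axDressK axVertexOfK decays_axDressK)
open ScalewiseWitness (secondMoment_add)
open Summit.QuantumFields.BalabanUV.Beta.TameKernelCalculus (Spr Loc tadpole_add)
open Summit.QuantumFields.BalabanUV.Beta.MixedJetTablesPlug (JsBalAn1 TbalOf_JsBalAn1 hB_an1 hmix_an1)
open Summit.QuantumFields.BalabanUV.Beta.GAN24.StencilSlotOfE3 (one_le_of_two_le)
open Summit.QuantumFields.BalabanUV.Gaps.CapTailPinnedLimitSign (tendsto_pinned d1Drift_pinned_iff_lim_eq)

namespace Summit.QuantumFields.BalabanUV.Gaps.D1PinnedSecondOrderUniversal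

variable {d : ℕ} {Lc : ℕ} [NeZero Lc]

/-! ## §1 The value-4-jet read-out of the assembled second-order member: base part plus `lin4 1` of the bi-stencil slot (private re-derivation) -/

/-- [folklore] The value-4-jet read-out of `WbalOf … T₂ … j` is that of `WbalOf … 0 … j` plus `lin4 1 (KInvStep Lc j) Lc (T₂ j)` (PRIVATE twin — statement and
proof verbatim — of this seat's GEN 9 `Gaps.D1PinnedBorderWeightAffine.e4OfW_WbalOf_eq_base_add_lin4`, whose module has no farm olean at the time of writing). -/
private theorem e4OfW_WbalOf_base_add_lin4 (hLc : 1 ≤ Lc) (cE cVH cΛ : ℝ)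
    {T₂ : ℕ → Fin (d + 1) → (Fin (d + 1) → ℤ) → Fin (d + 1) → (Fin (d + 1) → ℤ) → MKer (d + 1) (Fib d)}
    (hT₂ : ∀ j, ∃ C δ : ℝ, 0 < δ ∧ LocStencil₂ (T₂ j) C δ)
    {mixFF : Fin (d + 1) → (Fin (d + 1) → ℤ) → Fin (d + 1) → (Fin (d + 1) → ℤ) → MKer (d + 1) (Fib d)}
    (hmix : ∃ C δ : ℝ, 0 < δ ∧ LocStencilFM Lc mixFF C δ) (j : ℕ)
    (κ : Fin (d + 1)) (u : Fin (d + 1) → ℤ) (κ' : Fin (d + 1)) (u' : Fin (d + 1) → ℤ) :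
    e4OfW d Lc j (Spure d Lc cE cVH cΛ j) (M1 d Lc cΛ j) (WbalOf d Lc cE cVH cΛ T₂ mixFF j) κ u κ' u' =
      e4OfW d Lc j (Spure d Lc cE cVH cΛ j) (M1 d Lc cΛ j) (WbalOf d Lc cE cVH cΛ (fun _ => 0) mixFF j) κ u κ' u' +
        lin4 1 (KInvStep (d := d) Lc j) Lc (T₂ j) κ u κ' u' := by
  obtain ⟨δK, CK, hδK, hCK, hK⟩ := decays_KInvStep (Lc := Lc) (d := d) j
  have h0 : ∀ j, ∃ C δ : ℝ, 0 < δ ∧ LocStencil₂ ((fun _ : ℕ => (0 : Fin (d + 1) → (Fin (d + 1) → ℤ) → Fin (d + 1) → (Fin (d + 1) → ℤ) →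
      MKer (d + 1) (Fib d))) j) C δ := fun _ => ⟨0, 1, one_pos, locStencil₂_zero 1⟩
  obtain ⟨Cw, δw, hδw, hW⟩ := vertexFamily₂_WbalOf' (d := d) hLc cE cVH cΛ hT₂ hmix j
  obtain ⟨Cw₀, δw₀, hδw₀, hW₀⟩ := vertexFamily₂_WbalOf' (d := d) hLc cE cVH cΛ h0 hmix j
  set m : ℝ := min δK (min δw δw₀) with hm
  have hm0 : 0 < m := lt_min hδK (lt_min hδw hδw₀)
  have hKm : Decays (KInvStep (d := d) Lc j) CK m := decays_mono hK hCK le_rfl (min_le_left _ _)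
  have hCw : 0 ≤ Cw := (hW 0 0 0 0).nonneg (Sum.inl 0)
  have hCw₀ : 0 ≤ Cw₀ := (hW₀ 0 0 0 0).nonneg (Sum.inl 0)
  have hb : BiLoc (WbalOf d Lc cE cVH cΛ T₂ mixFF j κ u κ' u') ((Lc : ℤ) • u) ((Lc : ℤ) • u') Cw m :=
    biLoc_mono (hW κ u κ' u') hCw ((min_le_right _ _).trans (min_le_left _ _))
  have hb₀ : BiLoc (WbalOf d Lc cE cVH cΛ (fun _ => 0) mixFF j κ u κ' u') ((Lc : ℤ) • u) ((Lc : ℤ) • u') Cw₀ m :=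
    biLoc_mono (hW₀ κ u κ' u') hCw₀ ((min_le_right _ _).trans (min_le_right _ _))
  have hsplit : WbalOf d Lc cE cVH cΛ T₂ mixFF j = WbalOf d Lc cE cVH cΛ (fun _ => 0) mixFF j + vsym (KInvStep (d := d) Lc j) Lc (T₂ j) :=
    W2SymOfK_eq_add_vsym (KInvStep (d := d) Lc j) Lc _ _ _ _
  have hdiff : WbalOf d Lc cE cVH cΛ T₂ mixFF j κ u κ' u' - WbalOf d Lc cE cVH cΛ (fun _ => 0) mixFF j κ u κ' u' =
      vsym (KInvStep (d := d) Lc j) Lc (T₂ j) κ u κ' u' := by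
    rw [hsplit]; simp only [Pi.add_apply, add_sub_cancel_left]
  unfold BalabanStepW2.e4OfW
  rw [K3OfK_eq_sub_of_W hKm hm0 Lc _ _ hb hb₀, hdiff, mmRead_sub, lin4_apply, one_smul]
  abel

/-- [folklore] Entrywise bound of a `LocStencil₂` table by a larger constant. -/
private theorem abs_le_of_locStencil₂' {S₂ : Fin (d + 1) → (Fin (d + 1) → ℤ) → Fin (d + 1) → (Fin (d + 1) → ℤ) → MKer (d + 1) (Fib d)}
    {C δ : ℝ} (h : LocStencil₂ S₂ C δ) (hδ : 0 ≤ δ) {B : ℝ} (hB : C ≤ B)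
    (κ : Fin (d + 1)) (u : Fin (d + 1) → ℤ) (κ' : Fin (d + 1)) (u' x z : Fin (d + 1) → ℤ) (a b : Fib d) :
    |S₂ κ u κ' u' x z a b| ≤ B :=
  (abs_le_of_locStencil₂ h hδ κ u κ' u' x z a b).trans hB

/-! ## §2 The RESPONSE of an2's recursive bi-stencil family to its second-order data is FREE of the first-order colour constants -/

/-- [folklore] **THE SECOND-ORDER RESPONSE OF `T2Of` IS UNIVERSAL** (`1 ≤ Lc`, certified border ∕ mixed tables, any `cE₂ cB T`, ANY TWO triples of first-order constants
`(cE, cVH, cΛ)`, `(cE′, cVH′, cΛ′)`, every level `j`):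
`T2Of cE cVH cΛ cE₂ cB T … j + T2Of cE′ cVH′ cΛ′ cE₂ 0 0 … j = T2Of cE cVH cΛ cE₂ 0 0 … j + T2Of cE′ cVH′ cΛ′ cE₂ cB T … j`
— member `0` carries no first-order constant at all; member `j+1` from §1 (base part at the respective constants + the COLOUR-FREE `lin4 1 (KInvStep Lc j) Lc` of the
previous member), `Lin4Additive.lin4_add` on the bounded tables (`T2Of_loc`) and the induction hypothesis. -/
theorem T2Of_response_universal (hLc : 1 ≤ Lc) (cE cVH cΛ cE' cVH' cΛ' cE₂ cB : ℝ) (T : Fin 4 → Fin 4 → Fin 4 → Fin 4 → ℝ)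
    {B : Fin (d + 1) → (Fin (d + 1) → ℤ) → Fin (d + 1) → (Fin (d + 1) → ℤ) → MKer (d + 1) (Fib d)}
    (hB : ∃ C δ : ℝ, 0 < δ ∧ LocStencil₂ B C δ)
    {mixFF : Fin (d + 1) → (Fin (d + 1) → ℤ) → Fin (d + 1) → (Fin (d + 1) → ℤ) → MKer (d + 1) (Fib d)}
    (hmix : ∃ C δ : ℝ, 0 < δ ∧ LocStencilFM Lc mixFF C δ) :
    ∀ j : ℕ, T2Of d Lc cE cVH cΛ cE₂ cB T B mixFF j + T2Of d Lc cE' cVH' cΛ' cE₂ 0 0 B mixFF j =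
      T2Of d Lc cE cVH cΛ cE₂ 0 0 B mixFF j + T2Of d Lc cE' cVH' cΛ' cE₂ cB T B mixFF j
  | 0 => by
    funext κ u κ' u' x z a b
    simp only [T2Of_zero, Pi.add_apply, Pi.smul_apply, smul_eq_mul]
    ring
  | j + 1 => by
    have IH := T2Of_response_universal hLc cE cVH cΛ cE' cVH' cΛ' cE₂ cB T hB hmix j
    obtain ⟨C1, δ1, hδ1, hL1⟩ := T2Of_loc (d := d) hLc cE cVH cΛ cE₂ cB T hB hmix j
    obtain ⟨C2, δ2, hδ2, hL2⟩ := T2Of_loc (d := d) hLc cE' cVH' cΛ' cE₂ 0 0 hB hmix j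
    obtain ⟨C3, δ3, hδ3, hL3⟩ := T2Of_loc (d := d) hLc cE cVH cΛ cE₂ 0 0 hB hmix j
    obtain ⟨C4, δ4, hδ4, hL4⟩ := T2Of_loc (d := d) hLc cE' cVH' cΛ' cE₂ cB T hB hmix j
    obtain ⟨δK, CK, hδK, -, hK⟩ := decays_KInvStep (Lc := Lc) (d := d) j
    have hC1 : 0 ≤ C1 := (abs_nonneg _).trans (abs_le_of_locStencil₂ hL1 hδ1.le 0 0 0 0 0 0 (Sum.inl 0) (Sum.inl 0))
    have hC2 : 0 ≤ C2 := (abs_nonneg _).trans (abs_le_of_locStencil₂ hL2 hδ2.le 0 0 0 0 0 0 (Sum.inl 0) (Sum.inl 0))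
    have hC3 : 0 ≤ C3 := (abs_nonneg _).trans (abs_le_of_locStencil₂ hL3 hδ3.le 0 0 0 0 0 0 (Sum.inl 0) (Sum.inl 0))
    have hC4 : 0 ≤ C4 := (abs_nonneg _).trans (abs_le_of_locStencil₂ hL4 hδ4.le 0 0 0 0 0 0 (Sum.inl 0) (Sum.inl 0))
    have hb1 : ∀ κ u κ' u' x z a b, |T2Of d Lc cE cVH cΛ cE₂ cB T B mixFF j κ u κ' u' x z a b| ≤ C1 + C2 + C3 + C4 :=
      fun κ u κ' u' x z a b => abs_le_of_locStencil₂' hL1 hδ1.le (by linarith) κ u κ' u' x z a b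
    have hb2 : ∀ κ u κ' u' x z a b, |T2Of d Lc cE' cVH' cΛ' cE₂ 0 0 B mixFF j κ u κ' u' x z a b| ≤ C1 + C2 + C3 + C4 :=
      fun κ u κ' u' x z a b => abs_le_of_locStencil₂' hL2 hδ2.le (by linarith) κ u κ' u' x z a b
    have hb3 : ∀ κ u κ' u' x z a b, |T2Of d Lc cE cVH cΛ cE₂ 0 0 B mixFF j κ u κ' u' x z a b| ≤ C1 + C2 + C3 + C4 :=
      fun κ u κ' u' x z a b => abs_le_of_locStencil₂' hL3 hδ3.le (by linarith) κ u κ' u' x z a b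
    have hb4 : ∀ κ u κ' u' x z a b, |T2Of d Lc cE' cVH' cΛ' cE₂ cB T B mixFF j κ u κ' u' x z a b| ≤ C1 + C2 + C3 + C4 :=
      fun κ u κ' u' x z a b => abs_le_of_locStencil₂' hL4 hδ4.le (by linarith) κ u κ' u' x z a b
    have hlin : lin4 1 (KInvStep (d := d) Lc j) Lc (T2Of d Lc cE cVH cΛ cE₂ cB T B mixFF j) +
        lin4 1 (KInvStep (d := d) Lc j) Lc (T2Of d Lc cE' cVH' cΛ' cE₂ 0 0 B mixFF j) =
        lin4 1 (KInvStep (d := d) Lc j) Lc (T2Of d Lc cE cVH cΛ cE₂ 0 0 B mixFF j) +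
          lin4 1 (KInvStep (d := d) Lc j) Lc (T2Of d Lc cE' cVH' cΛ' cE₂ cB T B mixFF j) := by
      rw [← lin4_add hK hδK 1 Lc hb1 hb2, ← lin4_add hK hδK 1 Lc hb3 hb4, IH]
    funext κ u κ' u' x z a b
    have hl := congrArg (fun F => F κ u κ' u' x z a b) hlin
    simp only [Pi.add_apply] at hl
    simp only [T2Of_succ, Pi.add_apply, Pi.smul_apply]
    rw [e4OfW_WbalOf_base_add_lin4 hLc cE cVH cΛ (T2Of_loc (d := d) hLc cE cVH cΛ cE₂ cB T hB hmix) hmix j,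
      e4OfW_WbalOf_base_add_lin4 hLc cE' cVH' cΛ' (T2Of_loc (d := d) hLc cE' cVH' cΛ' cE₂ 0 0 hB hmix) hmix j,
      e4OfW_WbalOf_base_add_lin4 hLc cE cVH cΛ (T2Of_loc (d := d) hLc cE cVH cΛ cE₂ 0 0 hB hmix) hmix j,
      e4OfW_WbalOf_base_add_lin4 hLc cE' cVH' cΛ' (T2Of_loc (d := d) hLc cE' cVH' cΛ' cE₂ cB T hB hmix) hmix j]
    simp only [Pi.add_apply, smul_eq_mul]
    linear_combination (cE₂ * wV4 d Lc (j + 1)) * hl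

/-! ## §3 The response of the assembled second-order family is universal -/

/-- [folklore] **THE SECOND-ORDER RESPONSE OF `WbalOf … (T2Of …) … j` IS UNIVERSAL**: the symmetrised carrier is the (colour-dependent) `T₂`-free part plus `vsym` of the
bi-stencil slot (`W2SymOfK_eq_add_vsym`), `vsym` is additive on bounded tables (`Lin4Additive.vsym_add`), and §2; the `T₂`-free parts appear once on each side. -/
theorem WbalOf_T2Of_response_universal (hLc : 1 ≤ Lc) (cE cVH cΛ cE' cVH' cΛ' cE₂ cB : ℝ) (T : Fin 4 → Fin 4 → Fin 4 → Fin 4 → ℝ)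
    {B : Fin (d + 1) → (Fin (d + 1) → ℤ) → Fin (d + 1) → (Fin (d + 1) → ℤ) → MKer (d + 1) (Fib d)}
    (hB : ∃ C δ : ℝ, 0 < δ ∧ LocStencil₂ B C δ)
    {mixFF : Fin (d + 1) → (Fin (d + 1) → ℤ) → Fin (d + 1) → (Fin (d + 1) → ℤ) → MKer (d + 1) (Fib d)}
    (hmix : ∃ C δ : ℝ, 0 < δ ∧ LocStencilFM Lc mixFF C δ) (j : ℕ) :
    WbalOf d Lc cE cVH cΛ (T2Of d Lc cE cVH cΛ cE₂ cB T B mixFF) mixFF j +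
        WbalOf d Lc cE' cVH' cΛ' (T2Of d Lc cE' cVH' cΛ' cE₂ 0 0 B mixFF) mixFF j =
      WbalOf d Lc cE cVH cΛ (T2Of d Lc cE cVH cΛ cE₂ 0 0 B mixFF) mixFF j +
        WbalOf d Lc cE' cVH' cΛ' (T2Of d Lc cE' cVH' cΛ' cE₂ cB T B mixFF) mixFF j := by
  obtain ⟨C1, δ1, hδ1, hL1⟩ := T2Of_loc (d := d) hLc cE cVH cΛ cE₂ cB T hB hmix j
  obtain ⟨C2, δ2, hδ2, hL2⟩ := T2Of_loc (d := d) hLc cE' cVH' cΛ' cE₂ 0 0 hB hmix j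
  obtain ⟨C3, δ3, hδ3, hL3⟩ := T2Of_loc (d := d) hLc cE cVH cΛ cE₂ 0 0 hB hmix j
  obtain ⟨C4, δ4, hδ4, hL4⟩ := T2Of_loc (d := d) hLc cE' cVH' cΛ' cE₂ cB T hB hmix j
  obtain ⟨δK, CK, hδK, -, hK⟩ := decays_KInvStep (Lc := Lc) (d := d) j
  have hC1 : 0 ≤ C1 := (abs_nonneg _).trans (abs_le_of_locStencil₂ hL1 hδ1.le 0 0 0 0 0 0 (Sum.inl 0) (Sum.inl 0))
  have hC2 : 0 ≤ C2 := (abs_nonneg _).trans (abs_le_of_locStencil₂ hL2 hδ2.le 0 0 0 0 0 0 (Sum.inl 0) (Sum.inl 0))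
  have hC3 : 0 ≤ C3 := (abs_nonneg _).trans (abs_le_of_locStencil₂ hL3 hδ3.le 0 0 0 0 0 0 (Sum.inl 0) (Sum.inl 0))
  have hC4 : 0 ≤ C4 := (abs_nonneg _).trans (abs_le_of_locStencil₂ hL4 hδ4.le 0 0 0 0 0 0 (Sum.inl 0) (Sum.inl 0))
  have hb1 : ∀ κ u κ' u' x z a b, |T2Of d Lc cE cVH cΛ cE₂ cB T B mixFF j κ u κ' u' x z a b| ≤ C1 + C2 + C3 + C4 :=
    fun κ u κ' u' x z a b => abs_le_of_locStencil₂' hL1 hδ1.le (by linarith) κ u κ' u' x z a b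
  have hb2 : ∀ κ u κ' u' x z a b, |T2Of d Lc cE' cVH' cΛ' cE₂ 0 0 B mixFF j κ u κ' u' x z a b| ≤ C1 + C2 + C3 + C4 :=
    fun κ u κ' u' x z a b => abs_le_of_locStencil₂' hL2 hδ2.le (by linarith) κ u κ' u' x z a b
  have hb3 : ∀ κ u κ' u' x z a b, |T2Of d Lc cE cVH cΛ cE₂ 0 0 B mixFF j κ u κ' u' x z a b| ≤ C1 + C2 + C3 + C4 :=
    fun κ u κ' u' x z a b => abs_le_of_locStencil₂' hL3 hδ3.le (by linarith) κ u κ' u' x z a b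
  have hb4 : ∀ κ u κ' u' x z a b, |T2Of d Lc cE' cVH' cΛ' cE₂ cB T B mixFF j κ u κ' u' x z a b| ≤ C1 + C2 + C3 + C4 :=
    fun κ u κ' u' x z a b => abs_le_of_locStencil₂' hL4 hδ4.le (by linarith) κ u κ' u' x z a b
  have hv : vsym (KInvStep (d := d) Lc j) Lc (T2Of d Lc cE cVH cΛ cE₂ cB T B mixFF j) +
      vsym (KInvStep (d := d) Lc j) Lc (T2Of d Lc cE' cVH' cΛ' cE₂ 0 0 B mixFF j) =
      vsym (KInvStep (d := d) Lc j) Lc (T2Of d Lc cE cVH cΛ cE₂ 0 0 B mixFF j) +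
        vsym (KInvStep (d := d) Lc j) Lc (T2Of d Lc cE' cVH' cΛ' cE₂ cB T B mixFF j) := by
    funext μ y ν y'
    simp only [Pi.add_apply]
    rw [← vsym_add hK hδK Lc hb1 hb2, ← vsym_add hK hδK Lc hb3 hb4, T2Of_response_universal hLc cE cVH cΛ cE' cVH' cΛ' cE₂ cB T hB hmix j]
  unfold BalabanStepW2.WbalOf
  rw [W2SymOfK_eq_add_vsym (KInvStep (d := d) Lc j) Lc _ _ (T2Of d Lc cE cVH cΛ cE₂ cB T B mixFF j),
    W2SymOfK_eq_add_vsym (KInvStep (d := d) Lc j) Lc _ _ (T2Of d Lc cE' cVH' cΛ' cE₂ 0 0 B mixFF j),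
    W2SymOfK_eq_add_vsym (KInvStep (d := d) Lc j) Lc _ _ (T2Of d Lc cE cVH cΛ cE₂ 0 0 B mixFF j),
    W2SymOfK_eq_add_vsym (KInvStep (d := d) Lc j) Lc _ _ (T2Of d Lc cE' cVH' cΛ' cE₂ cB T B mixFF j)]
  funext μ y ν y' x z a b
  have hvp := congrArg (fun F => F μ y ν y' x z a b) hv
  simp only [Pi.add_apply] at hvp
  simp only [Pi.add_apply]
  linear_combination hvp

/-! ## §4 At `d = 3`: the response of the pinned literal's step kernels and (1.22) coefficients is universal -/

section Kernel

variable {D : ℕ} {F : Type*} [Fintype F]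

/-- [folklore] **`hessKer` IS MODULAR IN THE W-SLOT ACROSS TWO BUBBLE FAMILIES** (spread leg `A`; the bond-pair members localised): if `W₁ b + W₂ b = W₃ b + W₄ b` at the bond
pair read, then `hessKer A V W₁ + hessKer A V′ W₂ = hessKer A V W₃ + hessKer A V′ W₄` there — the tadpole is additive (`tadpole_add`), the two bubble halves appear once on
each side. -/
theorem hessKer_modular_W₂ {A : MKer D F} (hA : Spr A) (V V' : Fin D → (Fin D → ℤ) → MKer D F)
    {W₁ W₂ W₃ W₄ : Fin D → (Fin D → ℤ) → Fin D → (Fin D → ℤ) → MKer D F} (μ ν : Fin D) (z : Fin D → ℤ)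
    (h₁ : Loc (W₁ μ 0 ν z)) (h₂ : Loc (W₂ μ 0 ν z)) (h₃ : Loc (W₃ μ 0 ν z)) (h₄ : Loc (W₄ μ 0 ν z))
    (hsum : W₁ μ 0 ν z + W₂ μ 0 ν z = W₃ μ 0 ν z + W₄ μ 0 ν z) :
    hessKer A V W₁ μ ν z + hessKer A V' W₂ μ ν z = hessKer A V W₃ μ ν z + hessKer A V' W₄ μ ν z := by
  have ht : tadpole A (W₁ μ 0 ν z) + tadpole A (W₂ μ 0 ν z) = tadpole A (W₃ μ 0 ν z) + tadpole A (W₄ μ 0 ν z) := by rw [← tadpole_add hA h₁ h₂, ← tadpole_add hA h₃ h₄, hsum]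
  simp only [ExpKernelCalculus.hessKer]
  linear_combination (1 / 2 : ℝ) * ht

end Kernel

section Pinned

variable {Lc : ℕ} [NeZero Lc] {r : Fin (3 + 1) → ℕ}

/-- [folklore] The first-order part of an2's jet datum does not depend on the second-order tables or their certificates (PRIVATE twin of GEN 9's
`D1PinnedBorderWeightAffine.JsBal0Of_S_indep`; `rfl` by cases). -/
private theorem JsBal0Of_S_indep' (hLc : 1 ≤ Lc) (cE cVH cΛ : ℝ)
    (W W' : ℕ → Fin (3 + 1) → (Fin (3 + 1) → ℤ) → Fin (3 + 1) → (Fin (3 + 1) → ℤ) → MKer (3 + 1) (Fib 3))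
    (Cw δw : ℕ → ℝ) (hδw : ∀ j, 0 < δw j) (hW : ∀ j, VertexFamily₂ (W j) Lc (Cw j) (δw j))
    (Cw' δw' : ℕ → ℝ) (hδw' : ∀ j, 0 < δw' j) (hW' : ∀ j, VertexFamily₂ (W' j) Lc (Cw' j) (δw' j)) :
    ∀ j : ℕ, (JsBal0Of hLc cE cVH cΛ W Cw δw hδw hW j).S = (JsBal0Of hLc cE cVH cΛ W' Cw' δw' hδw' hW' j).S
  | 0 => rfl
  | _ + 1 => rfl

/-- [folklore] **THE SECOND-ORDER RESPONSE OF THE PINNED LITERAL's STEP KERNELS IS UNIVERSAL** (any `cE₂`, any box root, every level, every entry):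
`TbalOf Lc (JsBalAn1 c⃗ cB T) j b + TbalOf Lc (JsBalAn1 c⃗′ 0 0) j b = TbalOf Lc (JsBalAn1 c⃗ 0 0) j b + TbalOf Lc (JsBalAn1 c⃗′ cB T) j b`
— an1's closed form `TbalOf_JsBalAn1` ×4; the first-order part is free of the second-order data within each triple; the axial dressing `axDressK Lc (KInvStep Lc j)` is
COLOUR-FREE; §3; `hessKer_modular_W₂` (the two colour-dependent bubble families cancel pairwise). -/
theorem TbalOf_JsBalAn1_response_universal (hLc : 1 ≤ Lc) (hr : r ∈ box (3 + 1) Lc) (cE cVH cΛ cE' cVH' cΛ' cE₂ cB : ℝ)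
    (T : Fin 4 → Fin 4 → Fin 4 → Fin 4 → ℝ) (j : ℕ) (μ ν : Fin 4) (z : Fin 4 → ℤ) :
    TbalOf Lc (JsBalAn1 hLc hr cE cVH cΛ cE₂ cB T) j μ ν z + TbalOf Lc (JsBalAn1 hLc hr cE' cVH' cΛ' cE₂ 0 0) j μ ν z =
      TbalOf Lc (JsBalAn1 hLc hr cE cVH cΛ cE₂ 0 0) j μ ν z + TbalOf Lc (JsBalAn1 hLc hr cE' cVH' cΛ' cE₂ cB T) j μ ν z := by
  rw [TbalOf_JsBalAn1 hLc hr cE cVH cΛ cE₂ cB T j, TbalOf_JsBalAn1 hLc hr cE' cVH' cΛ' cE₂ 0 0 j, TbalOf_JsBalAn1 hLc hr cE cVH cΛ cE₂ 0 0 j,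
    TbalOf_JsBalAn1 hLc hr cE' cVH' cΛ' cE₂ cB T j]
  rw [JsBal0Of_S_indep' hLc cE cVH cΛ (WbalT2Of (Lc := Lc) cE cVH cΛ cE₂ cB T (vh₂S := vh₂SAt (toSite r) Lc) (mixFF := mixFFAt (toSite r) Lc))
      (WbalT2Of (Lc := Lc) cE cVH cΛ cE₂ 0 0 (vh₂S := vh₂SAt (toSite r) Lc) (mixFF := mixFFAt (toSite r) Lc)) _ _ _ _ _ _ _ _ j,
    JsBal0Of_S_indep' hLc cE' cVH' cΛ' (WbalT2Of (Lc := Lc) cE' cVH' cΛ' cE₂ cB T (vh₂S := vh₂SAt (toSite r) Lc) (mixFF := mixFFAt (toSite r) Lc))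
      (WbalT2Of (Lc := Lc) cE' cVH' cΛ' cE₂ 0 0 (vh₂S := vh₂SAt (toSite r) Lc) (mixFF := mixFFAt (toSite r) Lc)) _ _ _ _ _ _ _ _ j]
  have hW : WbalT2Of (Lc := Lc) cE cVH cΛ cE₂ cB T (vh₂S := vh₂SAt (toSite r) Lc) (mixFF := mixFFAt (toSite r) Lc) j +
      WbalT2Of (Lc := Lc) cE' cVH' cΛ' cE₂ 0 0 (vh₂S := vh₂SAt (toSite r) Lc) (mixFF := mixFFAt (toSite r) Lc) j =
      WbalT2Of (Lc := Lc) cE cVH cΛ cE₂ 0 0 (vh₂S := vh₂SAt (toSite r) Lc) (mixFF := mixFFAt (toSite r) Lc) j +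
        WbalT2Of (Lc := Lc) cE' cVH' cΛ' cE₂ cB T (vh₂S := vh₂SAt (toSite r) Lc) (mixFF := mixFFAt (toSite r) Lc) j :=
    WbalOf_T2Of_response_universal hLc cE cVH cΛ cE' cVH' cΛ' cE₂ cB T (hB_an1 hLc hr) (hmix_an1 hLc hr) j
  obtain ⟨δK, CK, hδK, -, hK⟩ := decays_KInvStep (Lc := Lc) (d := 3) j
  have hA : Spr (axDressK Lc (KInvStep (d := 3) Lc j)) := ⟨_, δK, hδK, decays_axDressK hLc hK hδK.le⟩
  obtain ⟨Cw1, δw1, hδw1, hW1⟩ := vertexFamily₂_WbalOf' (d := 3) hLc cE cVH cΛ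
    (T2Of_loc (d := 3) hLc cE cVH cΛ cE₂ cB T (hB_an1 hLc hr) (hmix_an1 hLc hr)) (hmix_an1 hLc hr) j
  obtain ⟨Cw2, δw2, hδw2, hW2⟩ := vertexFamily₂_WbalOf' (d := 3) hLc cE' cVH' cΛ'
    (T2Of_loc (d := 3) hLc cE' cVH' cΛ' cE₂ 0 0 (hB_an1 hLc hr) (hmix_an1 hLc hr)) (hmix_an1 hLc hr) j
  obtain ⟨Cw3, δw3, hδw3, hW3⟩ := vertexFamily₂_WbalOf' (d := 3) hLc cE cVH cΛ
    (T2Of_loc (d := 3) hLc cE cVH cΛ cE₂ 0 0 (hB_an1 hLc hr) (hmix_an1 hLc hr)) (hmix_an1 hLc hr) j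
  obtain ⟨Cw4, δw4, hδw4, hW4⟩ := vertexFamily₂_WbalOf' (d := 3) hLc cE' cVH' cΛ'
    (T2Of_loc (d := 3) hLc cE' cVH' cΛ' cE₂ cB T (hB_an1 hLc hr) (hmix_an1 hLc hr)) (hmix_an1 hLc hr) j
  have hsum := congrArg (fun F => F μ 0 ν z) hW
  simp only [Pi.add_apply] at hsum
  exact hessKer_modular_W₂ hA _ _ μ ν z ⟨_, _, _, _, hδw1, hW1 μ 0 ν z⟩ ⟨_, _, _, _, hδw2, hW2 μ 0 ν z⟩ ⟨_, _, _, _, hδw3, hW3 μ 0 ν z⟩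
    ⟨_, _, _, _, hδw4, hW4 μ 0 ν z⟩ hsum

/-- [folklore] **THE SECOND-ORDER RESPONSE OF THE PINNED LITERAL's ONE-LOOP STEP COEFFICIENTS IS UNIVERSAL** (any `cE₂`, any box root, every level, every channel):
`β⁰_j(c⃗;cB,T) + β⁰_j(c⃗′;0,0) = β⁰_j(c⃗;0,0) + β⁰_j(c⃗′;cB,T)` (`ScalewiseWitness.secondMoment_add` ×2, absolute moments by `OneStepKernelFamily.hTA_TbalOf`). -/
theorem secondMoment_JsBalAn1_response_universal (hLc : 1 ≤ Lc) (hr : r ∈ box (3 + 1) Lc) (cE cVH cΛ cE' cVH' cΛ' cE₂ cB : ℝ)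
    (T : Fin 4 → Fin 4 → Fin 4 → Fin 4 → ℝ) (j : ℕ) (μ ν : Fin 4) :
    B12Beta.secondMoment (TbalOf Lc (JsBalAn1 hLc hr cE cVH cΛ cE₂ cB T) j) μ ν +
        B12Beta.secondMoment (TbalOf Lc (JsBalAn1 hLc hr cE' cVH' cΛ' cE₂ 0 0) j) μ ν =
      B12Beta.secondMoment (TbalOf Lc (JsBalAn1 hLc hr cE cVH cΛ cE₂ 0 0) j) μ ν +
        B12Beta.secondMoment (TbalOf Lc (JsBalAn1 hLc hr cE' cVH' cΛ' cE₂ cB T) j) μ ν := by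
  have hker : TbalOf Lc (JsBalAn1 hLc hr cE cVH cΛ cE₂ cB T) j + TbalOf Lc (JsBalAn1 hLc hr cE' cVH' cΛ' cE₂ 0 0) j =
      TbalOf Lc (JsBalAn1 hLc hr cE cVH cΛ cE₂ 0 0) j + TbalOf Lc (JsBalAn1 hLc hr cE' cVH' cΛ' cE₂ cB T) j := by
    funext μ' ν' z
    simp only [Pi.add_apply]
    exact TbalOf_JsBalAn1_response_universal hLc hr cE cVH cΛ cE' cVH' cΛ' cE₂ cB T j μ' ν' z
  rw [← secondMoment_add (hTA_TbalOf (JsBalAn1 hLc hr cE cVH cΛ cE₂ cB T) j) (hTA_TbalOf (JsBalAn1 hLc hr cE' cVH' cΛ' cE₂ 0 0) j),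
    ← secondMoment_add (hTA_TbalOf (JsBalAn1 hLc hr cE cVH cΛ cE₂ 0 0) j) (hTA_TbalOf (JsBalAn1 hLc hr cE' cVH' cΛ' cE₂ cB T) j), hker]

end Pinned

/-! ## §5 UNCONDITIONAL at the pin `cE₂ := Lc^8`, `2 ≤ Lc`: the second-order response of the limit is universal -/

section Consequences

variable {Lc : ℕ} [NeZero Lc] {r : Fin (3 + 1) → ℕ}

/-- [folklore] **THE SECOND-ORDER RESPONSE OF THE LIMIT IS FREE OF THE FIRST-ORDER COLOUR CONSTANTS, HYPOTHESIS-FREE** (four-member form):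
`lim β⁰(c⃗;cB,Tc) + lim β⁰(c⃗′;0,0) = lim β⁰(c⃗;0,0) + lim β⁰(c⃗′;cB,Tc)` (§4 at every level + `tendsto_pinned` ×4 + `tendsto_nhds_unique`). -/
theorem lim_JsBalAn1_response_universal (hLc : 2 ≤ Lc) (hr : r ∈ box (3 + 1) Lc) (cE cVH cΛ cE' cVH' cΛ' cB : ℝ)
    (Tc : Fin 4 → Fin 4 → Fin 4 → Fin 4 → ℝ) (μ ν : Fin 4) :
    CauchyRate.lim (fun j => B12Beta.secondMoment (TbalOf Lc (JsBalAn1 (one_le_of_two_le hLc) hr cE cVH cΛ ((Lc : ℝ) ^ (2 * (3 + 1))) cB Tc) j) μ ν) +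
        CauchyRate.lim (fun j => B12Beta.secondMoment (TbalOf Lc (JsBalAn1 (one_le_of_two_le hLc) hr cE' cVH' cΛ' ((Lc : ℝ) ^ (2 * (3 + 1))) 0 0) j) μ ν) =
      CauchyRate.lim (fun j => B12Beta.secondMoment (TbalOf Lc (JsBalAn1 (one_le_of_two_le hLc) hr cE cVH cΛ ((Lc : ℝ) ^ (2 * (3 + 1))) 0 0) j) μ ν) +
        CauchyRate.lim (fun j => B12Beta.secondMoment (TbalOf Lc (JsBalAn1 (one_le_of_two_le hLc) hr cE' cVH' cΛ' ((Lc : ℝ) ^ (2 * (3 + 1))) cB Tc) j) μ ν) := by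
  have h1 := tendsto_pinned hLc hr cE cVH cΛ cB Tc μ ν
  have h2 := tendsto_pinned hLc hr cE' cVH' cΛ' 0 0 μ ν
  have h3 := tendsto_pinned hLc hr cE cVH cΛ 0 0 μ ν
  have h4 := tendsto_pinned hLc hr cE' cVH' cΛ' cB Tc μ ν
  exact tendsto_nhds_unique (h1.add h2) ((h3.add h4).congr fun j =>
    (secondMoment_JsBalAn1_response_universal (one_le_of_two_le hLc) hr cE cVH cΛ cE' cVH' cΛ' _ cB Tc j μ ν).symm)

/-! ## §6 Readings -/

/-- [folklore] **THE SECOND-ORDER RESPONSE OF `lim β⁰` DOES NOT SEE `(cE, cVH, cΛ)`**: `lim β⁰(c⃗;cB,Tc) − lim β⁰(c⃗;0,0) = lim β⁰(c⃗′;cB,Tc) − lim β⁰(c⃗′;0,0)` for any two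
triples of first-order colour constants (hypothesis-free).  With the sibling files and GEN 9's p370181 this response is `cB·σ + λ(Tc)`, so `σ` and `λ` are functions of
`Lc`, the root and the channel ALONE. -/
theorem secondOrderResponse_indep_firstOrder (hLc : 2 ≤ Lc) (hr : r ∈ box (3 + 1) Lc) (cE cVH cΛ cE' cVH' cΛ' cB : ℝ)
    (Tc : Fin 4 → Fin 4 → Fin 4 → Fin 4 → ℝ) (μ ν : Fin 4) :
    CauchyRate.lim (fun j => B12Beta.secondMoment (TbalOf Lc (JsBalAn1 (one_le_of_two_le hLc) hr cE cVH cΛ ((Lc : ℝ) ^ (2 * (3 + 1))) cB Tc) j) μ ν) -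
        CauchyRate.lim (fun j => B12Beta.secondMoment (TbalOf Lc (JsBalAn1 (one_le_of_two_le hLc) hr cE cVH cΛ ((Lc : ℝ) ^ (2 * (3 + 1))) 0 0) j) μ ν) =
      CauchyRate.lim (fun j => B12Beta.secondMoment (TbalOf Lc (JsBalAn1 (one_le_of_two_le hLc) hr cE' cVH' cΛ' ((Lc : ℝ) ^ (2 * (3 + 1))) cB Tc) j) μ ν) -
        CauchyRate.lim (fun j => B12Beta.secondMoment (TbalOf Lc (JsBalAn1 (one_le_of_two_le hLc) hr cE' cVH' cΛ' ((Lc : ℝ) ^ (2 * (3 + 1))) 0 0) j) μ ν) := by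
  linear_combination lim_JsBalAn1_response_universal hLc hr cE cVH cΛ cE' cVH' cΛ' cB Tc μ ν

/-- [folklore] **(D1) AT THE PINNED LITERAL WITH THE COLOUR DEPENDENCE SEPARATED, HYPOTHESIS-FREE**: for every numeral `N` and all colour data,
`D1Drift Lc (JsBalAn1 c⃗ … cB Tc) N μ ν ↔ lim β⁰(c⃗;0,0) + (lim β⁰(0⃗;cB,Tc) − lim β⁰(0⃗;0,0)) = stepBal N Lc`, `0⃗ = (0,0,0)`: the first-order constants enter only the
BASE value `lim β⁰(c⃗;0,0)`, the free second-order data only the UNIVERSAL correction (g1-p3's `d1Drift_pinned_iff_lim_eq` + §5 at `c⃗′ := 0⃗`). -/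
theorem d1Drift_JsBalAn1_iff_universal (hLc : 2 ≤ Lc) (hr : r ∈ box (3 + 1) Lc) (cE cVH cΛ cB : ℝ)
    (Tc : Fin 4 → Fin 4 → Fin 4 → Fin 4 → ℝ) (μ ν : Fin 4) (N : ℝ) :
    D1Drift Lc (JsBalAn1 (one_le_of_two_le hLc) hr cE cVH cΛ ((Lc : ℝ) ^ (2 * (3 + 1))) cB Tc) N μ ν ↔
      CauchyRate.lim (fun j => B12Beta.secondMoment (TbalOf Lc (JsBalAn1 (one_le_of_two_le hLc) hr cE cVH cΛ ((Lc : ℝ) ^ (2 * (3 + 1))) 0 0) j) μ ν) +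
          (CauchyRate.lim (fun j => B12Beta.secondMoment (TbalOf Lc (JsBalAn1 (one_le_of_two_le hLc) hr 0 0 0 ((Lc : ℝ) ^ (2 * (3 + 1))) cB Tc) j) μ ν) -
            CauchyRate.lim (fun j => B12Beta.secondMoment (TbalOf Lc (JsBalAn1 (one_le_of_two_le hLc) hr 0 0 0 ((Lc : ℝ) ^ (2 * (3 + 1))) 0 0) j) μ ν)) =
        B12Normalization.stepBal N Lc := by
  rw [d1Drift_pinned_iff_lim_eq hLc hr cE cVH cΛ cB Tc μ ν N]
  have h := lim_JsBalAn1_response_universal hLc hr cE cVH cΛ 0 0 0 cB Tc μ ν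
  constructor
  · intro h'; linear_combination h' - h
  · intro h'; linear_combination h' + h

/-- [folklore] **BLIND SOMEWHERE IS BLIND EVERYWHERE, HYPOTHESIS-FREE**: if at ONE triple of first-order constants `c⃗₀` the limit ignores the free second-order data
(`∀ cB Tc, lim β⁰(c⃗₀;cB,Tc) = lim β⁰(c⃗₀;0,0)`), then it ignores them at EVERY triple. -/
theorem blind_everywhere_of_blind_somewhere (hLc : 2 ≤ Lc) (hr : r ∈ box (3 + 1) Lc) (cE₀ cVH₀ cΛ₀ : ℝ) (μ ν : Fin 4)
    (hblind : ∀ (cB : ℝ) (Tc : Fin 4 → Fin 4 → Fin 4 → Fin 4 → ℝ),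
      CauchyRate.lim (fun j => B12Beta.secondMoment (TbalOf Lc (JsBalAn1 (one_le_of_two_le hLc) hr cE₀ cVH₀ cΛ₀ ((Lc : ℝ) ^ (2 * (3 + 1))) cB Tc) j) μ ν) =
      CauchyRate.lim (fun j => B12Beta.secondMoment (TbalOf Lc (JsBalAn1 (one_le_of_two_le hLc) hr cE₀ cVH₀ cΛ₀ ((Lc : ℝ) ^ (2 * (3 + 1))) 0 0) j) μ ν))
    (cE cVH cΛ cB : ℝ) (Tc : Fin 4 → Fin 4 → Fin 4 → Fin 4 → ℝ) :
    CauchyRate.lim (fun j => B12Beta.secondMoment (TbalOf Lc (JsBalAn1 (one_le_of_two_le hLc) hr cE cVH cΛ ((Lc : ℝ) ^ (2 * (3 + 1))) cB Tc) j) μ ν) =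
      CauchyRate.lim (fun j => B12Beta.secondMoment (TbalOf Lc (JsBalAn1 (one_le_of_two_le hLc) hr cE cVH cΛ ((Lc : ℝ) ^ (2 * (3 + 1))) 0 0) j) μ ν) := by
  linear_combination lim_JsBalAn1_response_universal hLc hr cE cVH cΛ cE₀ cVH₀ cΛ₀ cB Tc μ ν + hblind cB Tc

/-- [folklore] **UNDER BLINDNESS AT ONE TRIPLE, (D1) AT THE PINNED LITERAL SEES NONE OF ITS FREE SECOND-ORDER DATA AT ANY TRIPLE**: for every numeral and all
`(c⃗; cB, Tc)`, `D1Drift Lc (JsBalAn1 c⃗ … cB Tc) N μ ν ↔ D1Drift Lc (JsBalAn1 c⃗ … 0 0) N μ ν` (`d1Drift_pinned_iff_lim_eq` twice + `blind_everywhere_of_blind_somewhere`). -/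
theorem d1Drift_blind_everywhere_of_blind_somewhere (hLc : 2 ≤ Lc) (hr : r ∈ box (3 + 1) Lc) (cE₀ cVH₀ cΛ₀ : ℝ) (μ ν : Fin 4)
    (hblind : ∀ (cB : ℝ) (Tc : Fin 4 → Fin 4 → Fin 4 → Fin 4 → ℝ),
      CauchyRate.lim (fun j => B12Beta.secondMoment (TbalOf Lc (JsBalAn1 (one_le_of_two_le hLc) hr cE₀ cVH₀ cΛ₀ ((Lc : ℝ) ^ (2 * (3 + 1))) cB Tc) j) μ ν) =
      CauchyRate.lim (fun j => B12Beta.secondMoment (TbalOf Lc (JsBalAn1 (one_le_of_two_le hLc) hr cE₀ cVH₀ cΛ₀ ((Lc : ℝ) ^ (2 * (3 + 1))) 0 0) j) μ ν))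
    (cE cVH cΛ cB : ℝ) (Tc : Fin 4 → Fin 4 → Fin 4 → Fin 4 → ℝ) (N : ℝ) :
    D1Drift Lc (JsBalAn1 (one_le_of_two_le hLc) hr cE cVH cΛ ((Lc : ℝ) ^ (2 * (3 + 1))) cB Tc) N μ ν ↔
      D1Drift Lc (JsBalAn1 (one_le_of_two_le hLc) hr cE cVH cΛ ((Lc : ℝ) ^ (2 * (3 + 1))) 0 0) N μ ν := by
  rw [d1Drift_pinned_iff_lim_eq hLc hr cE cVH cΛ cB Tc μ ν N, d1Drift_pinned_iff_lim_eq hLc hr cE cVH cΛ 0 0 μ ν N,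
    blind_everywhere_of_blind_somewhere hLc hr cE₀ cVH₀ cΛ₀ μ ν hblind cE cVH cΛ cB Tc]

end Consequences

end Summit.QuantumFields.BalabanUV.Gaps.D1PinnedSecondOrderUniversal

end
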